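import Summits.Langlands.Langlands.Theses.OrdinaryPrimeTransport
import Literature.NumberTheory.Automorphic.ACCAutomorphyLiftingCrystalline
import Literature.NumberTheory.Automorphic.PolarizedCompatibleSystemRationalModelsProofs
import HarnessLib

/-!
# Line `WeightZeroLiftingRamifiedP` — G4 ladder-down rung (generation 35) on the crux
# `ReciprocityUpToIrreducibility` (item stmt-Langlands-14328; routes IrreducibilityBySelfDuality,
# OrdinaryPrimeTransport)

TOP `E` = `Summit.Langlands.Langlands.Theses.OrdinaryPrimeTransport.ReciprocityUpToIrreducibility` (the `Iff.rfl`-equal copy of `…Theses.IrreducibilityBySelfDuality.ReciprocityUpToIrreducibility`, item stmt-Langlands-14328 shared by both routes)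
(`Langlands ↔ E` landed: `Theorems.IrreducibleOffSector.langlands_iff_reciprocityUpToIrreducibility_of_JS`).

DIAL (in `E`'s own language, clause (B) Galois → automorphic): the RAMIFICATION OF `p` IN `F` in the
Calegari–Geraghty automorphy lifting theorem for `GL_n` at weight zero over CM / totally real `F`
(ACC+ Thm. 6.1.1 — the tree's named fact
`Literature.NumberTheory.Automorphic.ACCGHLNSTT2023.automorphyLifting_crystalline_weightZero`, whose
hypothesis "(2) `p` is unramified in `F`" is `Algebra.IsUnramifiedIn (𝓞 F) (Ideal.span {(p : ℤ)})`).
* `θ = 0`: `p` unramified in `F` (Fontaine–Laffaille regime) — FLOOR, in the tree (`floor_zero`).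
* `θ ≥ 1`: `p` arbitrarily ramified in `F`, and NO hypothesis connecting `ρ|Γ_{F_v}` to the seed
  `r_ι(π)|Γ_{F_v}` on the weight-0 crystalline deformation ring at `v ∣ p` — THE RUNG
  `WeightZeroLiftingRamifiedP = WeightZeroLifting 1` — OPEN: Barnet-Lamb–Caraiani–Gee–Newton–Taylor,
  *Potential automorphy and change of weight for `GL_n` over CM fields*, arXiv:2309.15880, Thm. 3.2.1
  proves it WITH hypothesis (5c) "`r_ι(π)|G_{F_v} ∼ ρ|G_{F_v}`" (same component), and p. 8: "in our
  `ℓ₀ > 0` situation such lifts do not always exist"; Caraiani–Newton arXiv:2301.10509 Thm. 5.2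
  (`n = 2`, potentially Barsotti–Tate) needs (5b) (p. 74: "which is why we need assumption (5b)").
  Catalogued barrier: `Literature.Barriers.Langlands.PatchingLocalComponentBarrier` (patching proves
  automorphy one component of the local deformation ring at a time); its `…Narrow` addendum records
  the known evasion class (Breuil–Mézard numerical criterion), which is this line's bet.

LINE SHAPE (three registered stubs, composition sorry-free, §7):
`stub_rung : WeightZeroLiftingRamifiedP` (the cap-lifting input) →
`stub_sectorMerge : WeightZeroLiftingRamifiedP → SectorGaloisToAutomorphic` (a.e. Satake ⇒ clause (B)
verbatim on the sector, every `Rec`) → `stub_offSector : OffSectorReciprocity` (E off the sector) →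
`ReciprocityUpToIrreducibility_of … : E` BY NAME.  §8: `E → every cell` and `Langlands → every cell`
(sorry-free; the on-path lemma `WeightZeroLiftingRamifiedP_of_Langlands`).
-/

noncomputable section

set_option linter.dupNamespace false

open scoped MatrixGroups Matrix NumberField Classical
open NumberField IsDedekindDomain Field Filter
open Literature.NumberTheory.Automorphic Literature.NumberTheory.GaloisRepresentations
open Literature.NumberTheory.PAdicHodge
open Summit.Langlands

namespace Summit.Langlands.Langlands.Cruxes.ReciprocityUpToIrreducibility.WeightZeroLiftingRamifiedP

/-! ## 1. The dial clause -/

/-- The **ramification clause** of the dial (the ONE hypothesis that moves): `θ = 0` — `p` is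
unramified in `F` (ACC+ Thm 6.1.1 (2), verbatim the tree's fact); `θ ≥ 1` — no condition. -/
def ramClause (F : Type) [Field F] [NumberField F] (p : ℕ) : ℕ → Prop
  | 0 => Algebra.IsUnramifiedIn (𝓞 F) (Ideal.span {(p : ℤ)})
  | _ + 1 => True

theorem ramClause_zero_iff (F : Type) [Field F] [NumberField F] (p : ℕ) :
    ramClause F p 0 ↔ Algebra.IsUnramifiedIn (𝓞 F) (Ideal.span {(p : ℤ)}) := Iff.rfl

theorem ramClause_succ (F : Type) [Field F] [NumberField F] (p θ : ℕ) :
    ramClause F p (θ + 1) := trivial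

/-- The clause only weakens as `θ` grows. -/
theorem ramClause_mono (F : Type) [Field F] [NumberField F] (p : ℕ) {θ θ' : ℕ} (hle : θ ≤ θ')
    (h : ramClause F p θ) : ramClause F p θ' := by
  cases θ' with
  | zero =>
    have : θ = 0 := Nat.le_zero.mp hle
    subst this; exact h
  | succ k => exact trivial

/-! ## 2. The weight-zero lifting hypotheses, the family, the rung -/

/-- **Local hypothesis at `v ∣ p`** (verbatim from the fact): `ρ|Γ_{F_v}` is crystalline for the
PINNED Fontaine datum with every labelled Hodge–Tate multiset `{0, 1, …, n-1}` (weight zero). -/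
def CrystallineWeightZeroAt (F : Type) [Field F] [NumberField F] (n p : ℕ) [Fact p.Prime]
    (ρ : FramedGaloisRep F (PadicAlgCl p) n) : Prop :=
  ∀ (v : HeightOneSpectrum (𝓞 F)) (hv : ((p : ℕ) : 𝓞 F) ∈ v.asIdeal),
    let D := fontainePstAdicCompletion v p hv
    D.IsCrystallineFramed (ρ.toLocal v) ∧
      (letI := D.algebra
       ∀ τ' : v.adicCompletion F →ₐ[ℚ_[p]] PadicAlgCl p,
         ρ.labelledHodgeTateWeightsAt v D.algebra D.𝔅 τ'.toRingHom =
           (Multiset.range n).map fun i : ℕ => (i : ℤ))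

/-- **Residual hypotheses and weight-zero seed** (verbatim from the fact): `τ = ρ̄` absolutely
irreducible, decomposed generic, absolutely irreducible on `Γ_{F(ζ_p)}` with enormous image, a scalar
`ρ̄(σ)` with `σ ∉ Γ_{F(ζ_p)}`; a cuspidal `π` of weight zero, unramified above `p`, HLTT-compatible
with some `r ≡ ρ (mod 𝔪)`.  NO hypothesis relating `ρ|Γ_{F_v}` and `r|Γ_{F_v}` at `v ∣ p`. -/
def ResidualSeed (F : Type) [Field F] [NumberField F] (n : ℕ)
    (hcpt : isCompact_glFiniteIntegralLevel n F) (p : ℕ) [Fact p.Prime] (ι : PadicAlgCl p ≃+* ℂ)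
    (ρ : FramedGaloisRep F (PadicAlgCl p) n)
    (τ : absoluteGaloisGroup F →* GL (Fin n) (padicAlgClResidueField p))
    (π : CuspidalAutomorphicRepData n F hcpt) (r : FramedGaloisRep F (PadicAlgCl p) n) : Prop :=
  ρ.IsResidualRepOf (RingHom.id _) τ ∧ IsAbsIrreducible τ ∧ IsDecomposedGeneric τ ∧
    IsAbsIrreducible (τ.comp (absGaloisGroupAdjoinRootsOfUnity F p).subtype) ∧
    Subgroup.IsEnormous ((absGaloisGroupAdjoinRootsOfUnity F p).map τ) ∧
    (∃ σ : absoluteGaloisGroup F, σ ∉ absGaloisGroupAdjoinRootsOfUnity F p ∧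
      ∃ c : padicAlgClResidueField p,
        ((τ σ : GL (Fin n) (padicAlgClResidueField p)) :
          Matrix (Fin n) (Fin n) (padicAlgClResidueField p)) = c • (1 : Matrix _ _ _)) ∧
    π.1.HasWeightZero ∧ HLTT.IsCompatible π.1 ι r ∧ r.IsResidualRepOf (RingHom.id _) τ ∧
    (∀ v : HeightOneSpectrum (𝓞 F), ((p : ℕ) : 𝓞 F) ∈ v.asIdeal → π.1.IsUnramifiedAt v)

/-- **Conclusion shape** (automorphy up to the normalisation twist): a cuspidal `Π` of
`GL_n(𝔸_F)` and `m : ℕ` with `Π ⊗ |det|^{(1-m)/2}` L-algebraic and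
`char ρ(Frob_v) = arithFrobPolyOfSatake ι q_v m (Satake Π_v)` at almost every `v`
(`m = n`: `ρ ≅ r_ι(Π)`, HLTT; `m = 1`: the summit's `SatakeFrobCompatibleAt`). -/
def AutomorphicAE (F : Type) [Field F] [NumberField F] (n : ℕ)
    (hcpt : isCompact_glFiniteIntegralLevel n F) (p : ℕ) [Fact p.Prime] (ι : PadicAlgCl p ≃+* ℂ)
    (ρ : FramedGaloisRep F (PadicAlgCl p) n) : Prop :=
  ∃ (Pi : CuspidalAutomorphicRepData n F hcpt) (m : ℕ),
    (∃ T : InfinityType F n, Pi.1.HasInfinityType T ∧ (T.twist ((1 - (m : ℂ)) / 2)).IsLAlgebraic) ∧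
    ∀ᶠ v : HeightOneSpectrum (𝓞 F) in cofinite, ∃ α : Multiset ℂ,
      Pi.1.HasSatakeParamAt v α ∧ ρ.IsUnramifiedAt v ∧
        ρ.HasFrobCharpolyAt v (arithFrobPolyOfSatake ι v.residueCard m α)

/-- **The rung family** `E(θ)`: weight-zero crystalline automorphy lifting for `GL_n` over CM /
totally real `F`, `p > n²`, `p > 2n`, ramification clause `ramClause θ`, for irreducible a.e.-unramified
`ρ` crystalline of weight zero above `p` with residual hypotheses and a weight-zero seed.
`θ = 0` IN THE TREE (ACC+ 6.1.1); `θ ≥ 1` OPEN (BCGNT Thm 3.2.1 minus its connectedness (5c)).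
[cite: AllenEtAl2023, Thm. 6.1.1] [cite: arXiv:2309.15880, Thm. 3.2.1, Rem. 3.2.2]
[cite: arXiv:2301.10509, Thm. 5.2, Rem. 5.2.3] -/
def WeightZeroLifting (θ : ℕ) : Prop :=
  ∀ (F : Type) [Field F] [NumberField F], IsTotallyReal F ∨ IsCMField F →
    ∀ (n : ℕ) (hcpt : isCompact_glFiniteIntegralLevel n F) (p : ℕ) [Fact p.Prime],
      0 < n → n ^ 2 < p → 2 * n < p → ramClause F p θ →
    ∀ (ι : PadicAlgCl p ≃+* ℂ) (ρ : FramedGaloisRep F (PadicAlgCl p) n)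
      (τ : absoluteGaloisGroup F →* GL (Fin n) (padicAlgClResidueField p))
      (π : CuspidalAutomorphicRepData n F hcpt) (r : FramedGaloisRep F (PadicAlgCl p) n),
      ρ.toGaloisRep.IsIrreducible →
      (∀ᶠ v : HeightOneSpectrum (𝓞 F) in cofinite, ρ.IsUnramifiedAt v) →
      CrystallineWeightZeroAt F n p ρ → ResidualSeed F n hcpt p ι ρ τ π r →
      AutomorphicAE F n hcpt p ι ρ

/-- **THE RUNG** (the filed statement): the family at `θ = 1` — weight-zero crystalline automorphy
lifting for `GL_n` over CM / totally real `F` with `p` ARBITRARILY RAMIFIED in `F` and no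
connectedness hypothesis at `v ∣ p`.  OPEN. -/
def WeightZeroLiftingRamifiedP : Prop := WeightZeroLifting 1

theorem rung_iff_family_one : WeightZeroLiftingRamifiedP ↔ WeightZeroLifting 1 := Iff.rfl

/-! ## 3. (F2) Monotonicity: a higher cell implies every lower cell -/

theorem mono {θ θ' : ℕ} (hle : θ ≤ θ') (h : WeightZeroLifting θ') : WeightZeroLifting θ := by
  intro F _ _ hF n hcpt p _ hn hn2 h2n hram
  exact h F hF n hcpt p hn hn2 h2n (ramClause_mono F p hle hram)

/-- Every cell `θ ≥ 1` is the rung (the dial is constant from `θ = 1` on). -/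
theorem family_succ_iff (θ : ℕ) : WeightZeroLifting (θ + 1) ↔ WeightZeroLiftingRamifiedP := by
  constructor
  · exact fun h => mono (by omega) h
  · intro h F _ _ hF n hcpt p _ hn hn2 h2n _
    exact h F hF n hcpt p hn hn2 h2n trivial

theorem floor_of_rung (h : WeightZeroLiftingRamifiedP) : WeightZeroLifting 0 := mono (by omega) h

/-! ## 4. (F3) Floor: `θ = 0` is the tree's named fact ACC+ Thm 6.1.1 (weight zero) -/

/-- The weight-zero infinity type twisted by `|det|^{(1-n)/2}` is L-algebraic. -/
theorem isLAlgebraic_twist_weightZero (n : ℕ) (F : Type) [Field F] :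
    ((weightZeroInfinityType n F).twist ((1 - (n : ℂ)) / 2)).IsLAlgebraic := by
  intro σ q hq
  simp only [InfinityType.twist_apply, weightZeroInfinityType_apply, Multiset.map_map,
    Function.comp_def, Multiset.mem_map, Finset.mem_val, Finset.mem_univ, true_and] at hq
  obtain ⟨i, rfl⟩ := hq
  refine ⟨-((i : ℕ) : ℤ), ((i : ℕ) : ℤ) + 1 - n, ?_, ?_⟩
  · simp [rhoGL]; ring
  · simp [rhoGL]; ring

/-- **FLOOR** `θ = 0` from the named fact (binders verbatim; `m = n`, `Π` of weight zero; a.e.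
Satake matching from HLTT-compatibility and Flath). -/
theorem floor_zero (hACC : ACCGHLNSTT2023.automorphyLifting_crystalline_weightZero) :
    WeightZeroLifting 0 := by
  intro F _ _ hF n hcpt p _ hn hn2 h2n hram ι ρ τ π r _hirr hunr hloc hseed
  obtain ⟨hres, hτ, hdg, hζ, henorm, hσ, hπ0, hcomp, hresr, hπp⟩ := hseed
  obtain ⟨Pi, hPi0, hc, -, -⟩ := hACC F hF n hcpt p hn2 h2n hram ι ρ τ π r hunr hloc hres hτ hdg
    hζ henorm hσ hπ0 hcomp hresr hπp
  refine ⟨Pi, n, ⟨weightZeroInfinityType n F, hPi0, isLAlgebraic_twist_weightZero n F⟩, ?_⟩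
  have hae := eventually_isGaloisCompatibleAt_of_isCompatible Pi (ι := ι) (r := ρ) hc
  have hcof : ∀ᶠ v : HeightOneSpectrum (𝓞 F) in cofinite, ∃ α : Multiset ℂ,
      Pi.1.HasSatakeParamAt v α := Pi.1.hasSatakeParamAt_cofinite_holds
  filter_upwards [hae, hcof] with v h1 ⟨α, hα⟩
  exact ⟨α, hα, (h1 α hα).1, (h1 α hα).2⟩

/-- F3 witness shape: the floor cell by `simpa` from the floor lemma. -/
example (h : ACCGHLNSTT2023.automorphyLifting_crystalline_weightZero) : WeightZeroLifting 0 := by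
  simpa using floor_zero h

/-! ## 5. The sector of clause (B) carried by the rung, the merge target, the complement -/

/-- **The weight-zero Calegari–Geraghty sector of clause (B)** at `(F, n, hcpt, p, ι, ρ)`: exactly the
rung's hypotheses beyond those clause (B) brings itself (irreducible, geometric) — `F` totally real or
CM, `p > n²`, `p > 2n`, `ρ` crystalline of weight zero above `p`, and SOME residual datum / seed
`(τ, π, r)`.  No ramification condition on `p` in `F`. -/
def InWeightZeroSector (F : Type) [Field F] [NumberField F] (n : ℕ)
    (hcpt : isCompact_glFiniteIntegralLevel n F) (p : ℕ) [Fact p.Prime] (ι : PadicAlgCl p ≃+* ℂ)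
    (ρ : FramedGaloisRep F (PadicAlgCl p) n) : Prop :=
  (IsTotallyReal F ∨ IsCMField F) ∧ n ^ 2 < p ∧ 2 * n < p ∧ CrystallineWeightZeroAt F n p ρ ∧
    ∃ (τ : absoluteGaloisGroup F →* GL (Fin n) (padicAlgClResidueField p))
      (π : CuspidalAutomorphicRepData n F hcpt) (r : FramedGaloisRep F (PadicAlgCl p) n),
      ResidualSeed F n hcpt p ι ρ τ π r

/-- **Merge target**: clause (B) of E VERBATIM (cuspidal, `L`-algebraic, `Corresponds Rec ι π ρ` —
a.e. Satake AND local–global compatibility at every finite place, at `v ∣ p` against `Rec.pst`) for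
EVERY reciprocity datum `Rec`, on the sector. -/
def SectorGaloisToAutomorphic : Prop :=
  ∀ (F : Type) [Field F] [NumberField F] (Rec : ReciprocityData F) (n : ℕ)
    (hcpt : isCompact_glFiniteIntegralLevel n F) (p : ℕ) [Fact p.Prime] (ι : PadicAlgCl p ≃+* ℂ)
    (ρ : FramedGaloisRep F (PadicAlgCl p) n),
    0 < n → ρ.toGaloisRep.IsIrreducible → IsGeometricFramed Rec ρ → InWeightZeroSector F n hcpt p ι ρ →
      ∃ π : CuspidalAutomorphicRepData n F hcpt, π.1.IsLAlgebraic ∧ Corresponds Rec ι π.1 ρ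

/-- **The off-sector complement**: E with clause (A′) entire and clause (B) restricted to `ρ` NOT in
the weight-zero sector (every `n`). -/
def OffSectorReciprocity : Prop :=
  ∀ (F : Type) [Field F] [NumberField F], ∃ Rec : ReciprocityData F,
    (∀ n : ℕ, 0 < n → ∀ hcpt : isCompact_glFiniteIntegralLevel n F,
      ∀ π : CuspidalAutomorphicRepData n F hcpt, π.1.IsLAlgebraic →
        ∀ (ℓ : ℕ) [Fact ℓ.Prime] (ι : PadicAlgCl ℓ ≃+* ℂ),
          ∃ ρ : FramedGaloisRep F (PadicAlgCl ℓ) n, IsGeometricFramed Rec ρ ∧ Corresponds Rec ι π.1 ρ) ∧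
    (∀ n : ℕ, 0 < n → ∀ (hcpt : isCompact_glFiniteIntegralLevel n F) (ℓ : ℕ) [Fact ℓ.Prime]
      (ι : PadicAlgCl ℓ ≃+* ℂ) (ρ : FramedGaloisRep F (PadicAlgCl ℓ) n),
      ρ.toGaloisRep.IsIrreducible → IsGeometricFramed Rec ρ → ¬ InWeightZeroSector F n hcpt ℓ ι ρ →
        ∃ π : CuspidalAutomorphicRepData n F hcpt, π.1.IsLAlgebraic ∧ Corresponds Rec ι π.1 ρ)

/-! ## 6. The three registered stubs -/

/-- **THE RUNG / cap-lifting input**: weight-zero crystalline automorphy lifting for `GL_n` over CM /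
totally real fields with `p` arbitrarily ramified and no connectedness hypothesis at `v ∣ p`.  OPEN:
BCGNT Thm. 3.2.1 proves it with (5c) `r_ι(π)|G_{F_v} ∼ ρ|G_{F_v}`; removing (5c) needs a way to change
components of the weight-0 crystalline deformation ring at `v ∣ p` in positive defect `ℓ₀ > 0` — the
catalogued `PatchingLocalComponentBarrier`; the line's bet is its numerical (Breuil–Mézard) evasion:
BM for weight-0 crystalline deformation rings over arbitrary `K/ℚ_p` (`n = 2`: Gee–Kisin; `n = 3`:
Bartlett–Le Hung–Levin 2026 Thm. 1.3; `n ≥ 4`: BCGNT Thm. D = generic reducedness only) fed through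
the Calegari–Geraghty patched complex with Caraiani–Newton's crystalline local–global compatibility. -/
theorem stub_rung : WeightZeroLiftingRamifiedP := by
  sorry

/-- Sector merge: from a.e.-Satake automorphy up to the normalisation twist (the rung) to clause (B)
of E verbatim on `InWeightZeroSector`, for every `Rec`: re-normalise `Π ⊗ |det|^{(n-m)/2}`… to the
summit's `m = 1`, cuspidality kept, `L`-algebraicity, and local–global compatibility at EVERY finite
place (at `v ∤ p`: Varma up to semisimplification + purity; at `v ∣ p`: crystalline for the pinned
datum by hypothesis, Caraiani–Newton / A'Campo for `r_ι(Π)`), strong multiplicity one. -/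
theorem stub_sectorMerge : WeightZeroLiftingRamifiedP → SectorGaloisToAutomorphic := by
  sorry

/-- The honest complement: E off the sector. -/
theorem stub_offSector : OffSectorReciprocity := by
  sorry

/-! ## 7. Composition (no sorry below this line) -/

/-- **THE REGISTERED SKELETON THEOREM** — the item's decl from the three registered stubs BY NAME
(audit: proof-of-item modulo the three sorries).  `Rec`, clause (A′) and clause (B) off the sector come
from `stub_offSector`; on the sector the RUNG `stub_rung` feeds the merge `stub_sectorMerge`. -/
theorem ReciprocityUpToIrreducibility_proof :
    Summit.Langlands.Langlands.Theses.OrdinaryPrimeTransport.ReciprocityUpToIrreducibility := by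
  intro F _ _
  obtain ⟨Rec, hA, hBoff⟩ := stub_offSector F
  refine ⟨Rec, fun n hn hcpt => ⟨hA n hn hcpt, ?_⟩⟩
  intro ℓ _ ι ρ hirr hgeo
  by_cases hsec : InWeightZeroSector F n hcpt ℓ ι ρ
  · exact stub_sectorMerge stub_rung F Rec n hcpt ℓ ι ρ hn hirr hgeo hsec
  · exact hBoff n hn hcpt ℓ ι ρ hirr hgeo hsec

/-- The TOP, under a reducible alias (so that exactly ONE theorem of this file — the registered
`ReciprocityUpToIrreducibility_proof` above — concludes the item's decl syntactically). -/
abbrev TopCrux : Prop :=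
  Summit.Langlands.Langlands.Theses.OrdinaryPrimeTransport.ReciprocityUpToIrreducibility

example : TopCrux = Summit.Langlands.Langlands.Theses.OrdinaryPrimeTransport.ReciprocityUpToIrreducibility :=
  rfl

/-- **COMPOSITION (hypothesis form)** — the crux from the three stub STATEMENTS, kernel-checked, no sorry:
the implication `stub_rung-sig → stub_sectorMerge-sig → stub_offSector-sig → crux` (`TopCrux` unfolds to the
item's decl by `rfl`). -/
theorem ReciprocityUpToIrreducibility_of :
    WeightZeroLiftingRamifiedP → (WeightZeroLiftingRamifiedP → SectorGaloisToAutomorphic) →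
    OffSectorReciprocity → TopCrux := by
  intro hrung hmerge hoff F _ _
  obtain ⟨Rec, hA, hBoff⟩ := hoff F
  refine ⟨Rec, fun n hn hcpt => ⟨hA n hn hcpt, ?_⟩⟩
  intro ℓ _ ι ρ hirr hgeo
  by_cases hsec : InWeightZeroSector F n hcpt ℓ ι ρ
  · exact hmerge hrung F Rec n hcpt ℓ ι ρ hn hirr hgeo hsec
  · exact hBoff n hn hcpt ℓ ι ρ hirr hgeo hsec

/-- The rung from the registered stubs (it is load-bearing: `ReciprocityUpToIrreducibility_of` passes
it to the merge). -/
theorem rung_of_stubs : WeightZeroLiftingRamifiedP := stub_rung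

/-! ## 8. The rung is a consequence of the top and of the summit (sorry-free) -/

theorem twist_zero' {F : Type} [Field F] {n : ℕ} (T : InfinityType F n) : T.twist 0 = T := by
  funext σ
  simp [InfinityType.twist]

/-- Clause (B) at SOME datum for every `F` gives every cell: the local clause of the cell is stated
against the PINNED Fontaine datum `fontainePstAdicCompletion v p hv = Rec.pst p v hv` (`rfl`),
crystalline ⇒ de Rham, so `IsGeometricFramed Rec ρ`; `Corresponds Rec ι Π ρ` contains a.e.
Satake–Frobenius matching with `m = 1`, and `Π` is L-algebraic (`T ⊗ |det|^0 = T`). -/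
theorem family_of_clauseB (θ : ℕ)
    (hB : ∀ (F : Type) [Field F] [NumberField F], ∃ Rec : ReciprocityData F,
      ∀ n : ℕ, 0 < n → ∀ hcpt : isCompact_glFiniteIntegralLevel n F, GaloisToAutomorphic n Rec hcpt) :
    WeightZeroLifting θ := by
  intro F _ _ _hF n hcpt p _ hn _hn2 _h2n _hram ι ρ τ π r hirr hunr hloc _hseed
  obtain ⟨Rec, hall⟩ := hB F
  have hBn : GaloisToAutomorphic n Rec hcpt := hall n hn hcpt
  have hdR : ∀ (v : HeightOneSpectrum (𝓞 F)) (hv : ((p : ℕ) : 𝓞 F) ∈ v.asIdeal),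
      (Rec.pst p v hv).IsDeRhamFramed (ρ.toLocal v) := by
    intro v hv
    change (fontainePstAdicCompletion v p hv).IsDeRhamFramed (ρ.toLocal v)
    exact (hloc v hv).1.isDeRhamFramed
  have hgeo : IsGeometricFramed Rec ρ := ⟨hunr, hdR⟩
  obtain ⟨Pi, ⟨T, hT, hTL⟩, hcorr⟩ := hBn p ι ρ hirr hgeo
  refine ⟨Pi, 1, ⟨T, hT, ?_⟩, ?_⟩
  · have h0 : ((1 - ((1 : ℕ) : ℂ)) / 2) = 0 := by norm_num
    rw [h0, twist_zero']
    exact hTL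
  · exact hcorr.1

/-- `E → every cell`. -/
theorem family_of_top (θ : ℕ)
    (hE : Summit.Langlands.Langlands.Theses.OrdinaryPrimeTransport.ReciprocityUpToIrreducibility) :
    WeightZeroLifting θ :=
  family_of_clauseB θ fun F _ _ => by
    obtain ⟨Rec, hall⟩ := hE F
    exact ⟨Rec, fun n hn hcpt => (hall n hn hcpt).2⟩

/-- `E → rung`. -/
theorem WeightZeroLiftingRamifiedP_of_top
    (hE : Summit.Langlands.Langlands.Theses.OrdinaryPrimeTransport.ReciprocityUpToIrreducibility) :
    WeightZeroLiftingRamifiedP :=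
  family_of_top 1 hE

/-- `Langlands → every cell`. -/
theorem family_of_langlands (θ : ℕ) (hL : _root_.Langlands) : WeightZeroLifting θ :=
  family_of_clauseB θ fun F _ _ => by
    obtain ⟨⟨Rec⟩, hall⟩ := hL F
    exact ⟨Rec, fun n hn hcpt => (hall Rec n hn hcpt).2⟩

/-- **F4 on-path lemma for the rung**: `Langlands → WeightZeroLiftingRamifiedP`. -/
@[aesop safe apply]
theorem WeightZeroLiftingRamifiedP_of_Langlands (hL : _root_.Langlands) :
    WeightZeroLiftingRamifiedP :=
  family_of_langlands 1 hL

example : _root_.Langlands → WeightZeroLiftingRamifiedP := by intro h; aesop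

end Summit.Langlands.Langlands.Cruxes.ReciprocityUpToIrreducibility.WeightZeroLiftingRamifiedP

end
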